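import Summits.QuantumFields.YangMills.Theorems.FluctuationComparisonRegPrIntLS2BetaChartReadDerivKStepSup
import Summits.QuantumFields.YangMills.Theorems.FluctuationComparisonRegPrIntLS2BetaChartReadDerivLocal
import Summits.QuantumFields.YangMills.Theorems.FluctuationComparisonRegPrIntLS2BetaSecondOrderTwoBlockCount
import Summits.QuantumFields.YangMills.Theorems.FluctuationComparisonRegPrIntLS2BetaAveragingWordCounts
import HarnessLib

/-!
# S2β · AVG₂♭-ax_q route, brick (P′) part 2 — «(D2-ℓ¹)», ONE STEP: the decomposition step of ✓p826096 (D2) re-run in `ℓ¹` over bonds with the word counts of part 1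
# (`‖M′‖₁ ≤ (L^{1−d} + O(α))‖M‖₁ + O(α)‖Φ‖₁`, `‖Φ′‖₁ ≤ (d+2)L‖M‖₁ + ‖Φ‖₁`); the k-step bound `Σ_B ‖↑((DΨ_k(0) X) B)‖ ≤ A_{d,L}·e^{c_{d,L}Σα}·Σ_b ‖↑(X b)‖` is part 3

Cell `ym3-torus` (YM ladder rung R3 = continuum `SU(2)` Yang–Mills on the three-torus at fixed lattice data — a RUNG: NOT d = 4, NOT infinite volume,
NOT a mass gap, NOT Clay).  Width seat «width 20» `ym3-torus-px20` (gen 23), FREE px helper on crux `stmt-QuantumFields-20520`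
(`…Theses.UnitScaleTilt.FluctuationComparisonRegPrIntL`), LINE g18-1 S2β, pairing lane; AVG₂♭-ax_q ⟸ `hLoc` (px16 g22 ✓∕⧗`…S2BetaTaylorOfLocal`): the k-step second-order
remainder of the quaternion read telescopes (Q7 ✓p827759) into one-step brackets PROPAGATED by `DMq_{J←J+t} = DΨ_t(0)`; ✓p826096 (D2) bounds that propagation sup → sup with the
constant-field growth `L` per step (`(1+4(d+2))e^{c₃Σα}·L^k`), which overshoots the letter's purse by `N²` (UV3-NODE §89.4).  THIS FILE: the SAME bootstrap in `ℓ¹` over bonds,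
where the line mean CONTRACTS by `L^{1−d}` (run count, part 1 ✓`sum_runSums_eq`), the gauge part is carried by restriction `Φ ↦ SM(M) + Φ∘emb` at `ℓ¹`-cost `(d+2)L` (stair count
✓`sum_stairSums_le`), and the `O(α)` defects of (D1-loc)∕(s1′)∕(s2′) are turned from local-sup into `ℓ¹` by the two-block count (✓p828332 `sum_sum_twoBlock_le`): the transfer
matrix `[[L^{1−d}, 0],[(d+2)L, 1]]` is POWER-BOUNDED, so `m + κφ` (`κ = (1 − L^{1−d})∕(2(d+2)L)`) grows by at most `(1 + c·α_i)` per level — depth-free under `Σα` alone.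
`--kind proof --supports stmt-QuantumFields-20520 --as helper`, count-neutral, DEFINITION-FREE (0 `def`, 0 `instance`, 0 `notation`, 0 `sorry`), default heartbeats; generic
`P : Params` with `2 ≤ d`, `SU(N)`.

WHAT IS PROVED (sorry-free).
* §1 `ℓ¹` letters: `norm_covWalkSum_le_sum` (`‖Y_V(Γ)‖ ≤ Σ_{s∈Γ}‖Y s.bond‖`), `norm_truncate_le_sum` (`‖Y^{(c)}‖_∞ ≤ Σ_{b ∈ blocks(c)}‖Y b‖`), `sum_norm_covGrad_le`
  (`‖D_VΦ‖_{ℓ¹} ≤ 2d·‖Φ‖_{ℓ¹(sites)}`), `norm_mean_le_mean_norm`.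
* §2 ★`norm_covLinAvgR0_sub_structure_avgFun_le_local` — (s2′) with the LOCAL sup `‖M^{(c)}‖` on the right (✓(s2′) at `M^{(c)}` + block locality of all four terms).
* §3 ★★`decomp_step_ell1` — ONE STEP in `ℓ¹`: from `Y = M + D_VΦ` and `‖Y′(c) − Q₁^{R₀}(V)Y(c)‖ ≤ r·Σ_{b∈blocks(c)}‖Y b‖`:  `Y′ = M′ + D_{ŪV}Φ′` (the SAME `M′, Φ′` as ✓`decomp_step`) with
  **`‖M′‖₁ ≤ (ρ + 12dℓα + 2dr)·‖M‖₁ + (6dα + 4d²r)·‖Φ‖₁`**, **`‖Φ′‖₁ ≤ ℓ·‖M‖₁ + ‖Φ‖₁`**, `ρ = (d!)²L∕|I| = L^{1−d}`, `ℓ = (d+2)L`.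
* (part 3 `…ChartReadDerivKStepEllOneTower`: the bootstrap `‖M_i‖₁ + κ‖Φ_i‖₁ ≤ Π_{j<i}(1 + c·α_j)·‖X‖₁` and (D2-ℓ¹) itself.)

HONEST SCOPE.  Real-analysis bookkeeping over (D0)(D1)(D1-loc)∕F1 and the counts; the constants are crude but free of `k`, of the volume and of any power of `L^k`; nothing of
Bałaban's renormalisation analysis is asserted or proved beyond the printed Prop. 3 already in the tree ([Balaban1985Averaging] (139)–(147) bound the AXIAL-gauge operator in the
scaled sup norm — this is the tree's (0.4) reading in `ℓ¹`, a different norm); the one-step bracket bound in curl currency, the tower budget of the stage chords, `hLoc`, AVG₂♭-ax_q,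
«MULT♭-ax»∕«CRIT-ax», (D-ax), GAP♯∘ (`stub_uniformFibreGapOrbit`; registry UNTOUCHED), the five REGISTERED stubs, S2β, crux 20520, 19936, 19200 and `YM3TorusSU2` are NOT proved; no
summit statement is proved by a helper; rung R3 = SU(2) YM₃ on T³ at fixed lattice data — NOT d = 4, NOT infinite volume, NOT a mass gap, NOT Clay; the Yang–Mills mass gap is NOT
proved.  Axioms standard.

References: T. Bałaban, CMP **98** (1985) 17–51 [Balaban1985Averaging] (Prop. 3 (121)–(126) p.36, Prop. 4 p.37, (139)–(147) pp.39–40); CMP **109** (1987) 249–301 [Balaban1987RG1]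
((0.3)–(0.4), (0.11) pp.252–253).
-/

set_option autoImplicit false

noncomputable section

open scoped BigOperators Matrix.Norms.L2Operator Topology
open Filter Set Function

namespace Summit.QuantumFields.YangMills.Theorems.FluctuationComparisonRegPrIntLS2BetaChartReadDerivKStepEllOne

open Literature.MathematicalPhysics.QuantumFieldTheory.Balaban1983to89
open Literature.MathematicalPhysics.QuantumFieldTheory.Balaban1983to89.T4Continuum
open Literature.MathematicalPhysics.QuantumFieldTheory.Balaban1983to89.HaarExponentialChart
open Literature.MathematicalPhysics.QuantumFieldTheory.Balaban1983to89.HaarExponentialChart.IsChartRep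
open Literature.MathematicalPhysics.QuantumFieldTheory.Balaban1983to89.BlockAveraging
open Literature.MathematicalPhysics.QuantumFieldTheory.Balaban1983to89.AveragingRT
open Literature.MathematicalPhysics.QuantumFieldTheory.Balaban1983to89.ExpMeanLog (expMeanLogSU deltaSU)
open Literature.MathematicalPhysics.QuantumFieldTheory.Balaban1983to89.Node00
open Literature.MathematicalPhysics.QuantumFieldTheory.Balaban1983to89.BlockAveragingEMLLinearised (stepFactor walkEnd_emb_stairWord_eq_blockSite)
open Literature.MathematicalPhysics.QuantumFieldTheory.Balaban1983to89.BlockAveragingEMLLinearisedBackground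
  (covStep covWalkSum covWalkSum_nil covWalkSum_cons covLinAvgR0 covLinAvgR0_add norm_covStep_le)
open Literature.MathematicalPhysics.QuantumFieldTheory.Balaban1983to89.B12B0LoopGeometry267 (stair_src_tgt_blockOf)
open Summit.QuantumFields.YangMills.BalabanUVNodes.N09ChartReadAveragingSmooth
open Summit.QuantumFields.YangMills.Theorems.Prop7HolRatioPerStep (norm_coe_eq_one norm_star_coe_eq_one)
open Summit.QuantumFields.YangMills.Theorems.FluctuationComparisonRegPrIntLS2BetaChartReadDescentChainRule (fderiv_chartRead_iter_succ_apply fderiv_chartRead_iter_zero)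
open Summit.QuantumFields.YangMills.Theorems.FluctuationComparisonRegPrIntLS2BetaChartReadDerivStructure
  (norm_covGrad_le norm_covLinAvgR0_sub_structure_avgFun_le norm_covLinAvgR0_covGrad_sub_le)
open Summit.QuantumFields.YangMills.Theorems.FluctuationComparisonRegPrIntLS2BetaChartReadDerivKStepSup (norm_coe_comp_eq one_le_prod_one_add prod_one_add_le_exp_sum)
open Summit.QuantumFields.YangMills.Theorems.FluctuationComparisonRegPrIntLS2BetaChartReadDerivLocal
  (covWalkSum_congr blockOf_src_of_mem_line covLinAvgR0_local norm_fderiv_chartRead_sub_covLinAvgR0_le_local)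
open Summit.QuantumFields.YangMills.Theorems.FluctuationComparisonRegPrIntLS2BetaSecondOrderTwoBlockCount (sum_sum_twoBlock_le)
open Summit.QuantumFields.YangMills.Theorems.FluctuationComparisonRegPrIntLS2BetaAveragingWordCounts
  (sum_bond_src sum_bond_tgt sum_emb_le sum_runSums_eq sum_stairSums_le)

variable {P : Params} {N : ℕ} [NeZero N] {j : ℕ}

/-! ## §1 `ℓ¹` letters -/

section Letters

/-- `‖g·X·g*‖ ≤ ‖X‖` for the background step factor. [folklore] -/
theorem norm_conj_stepFactor_le' (U₀ : GaugeField P j (SU N)) (s : LStep P j) (X : Matrix (Fin N) (Fin N) ℂ) :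
    ‖stepFactor U₀ s * X * star (stepFactor U₀ s)‖ ≤ ‖X‖ := by
  have h1 : ‖stepFactor U₀ s‖ = 1 := by
    unfold stepFactor
    cases s.fwd
    · simp only [Bool.false_eq_true, ↓reduceIte]; exact norm_star_coe_eq_one _
    · simp only [↓reduceIte]; exact norm_coe_eq_one _
  have h2 : ‖star (stepFactor U₀ s)‖ = 1 := by
    unfold stepFactor
    cases s.fwd
    · simp only [Bool.false_eq_true, ↓reduceIte, star_star]; exact norm_coe_eq_one _
    · simp only [↓reduceIte]; exact norm_star_coe_eq_one _
  calc _ ≤ ‖stepFactor U₀ s‖ * ‖X‖ * ‖star (stepFactor U₀ s)‖ :=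
        (norm_mul_le _ _).trans (mul_le_mul_of_nonneg_right (norm_mul_le _ _) (norm_nonneg _))
    _ = ‖X‖ := by rw [h1, h2, one_mul, mul_one]

/-- **THE `ℓ¹`-ALONG-THE-WALK BOUND**: `‖Y_{U₀}(Γ)‖ ≤ Σ_{s ∈ Γ} ‖Y s.bond‖`. [cite: Balaban1985Averaging, (58) p.27 (bookkeeping)] -/
theorem norm_covWalkSum_le_sum (U₀ : GaugeField P j (SU N)) (Y : PBond P j → Matrix (Fin N) (Fin N) ℂ) :
    ∀ γ : List (LStep P j), ‖covWalkSum U₀ Y γ‖ ≤ (γ.map fun s => ‖Y s.bond‖).sum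
  | [] => by rw [covWalkSum_nil, norm_zero, List.map_nil, List.sum_nil]
  | s :: γ => by
    rw [covWalkSum_cons, List.map_cons, List.sum_cons]
    calc _ ≤ ‖covStep U₀ Y s‖ + ‖stepFactor U₀ s * covWalkSum U₀ Y γ * star (stepFactor U₀ s)‖ := norm_add_le _ _
      _ ≤ ‖Y s.bond‖ + (γ.map fun s => ‖Y s.bond‖).sum :=
          add_le_add (norm_covStep_le U₀ Y s) ((norm_conj_stepFactor_le' U₀ s _).trans (norm_covWalkSum_le_sum U₀ Y γ))

omit [NeZero N] in
/-- The mean of a finite family has norm at most the mean of the norms. [folklore] -/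
theorem norm_mean_le_mean_norm {ι : Type*} [Fintype ι] (m : ι → Matrix (Fin N) (Fin N) ℂ) :
    ‖((Fintype.card ι : ℂ))⁻¹ • ∑ i, m i‖ ≤ ((Fintype.card ι : ℝ))⁻¹ * ∑ i, ‖m i‖ := by
  rw [norm_smul, norm_inv, Complex.norm_natCast]
  exact mul_le_mul_of_nonneg_left (norm_sum_le _ _) (inv_nonneg.2 (Nat.cast_nonneg _))

/-- The sup norm of a block truncation is at most the `ℓ¹` sum over the kept bonds. [folklore] -/
theorem norm_truncate_le_sum {E : Type*} [NormedAddCommGroup E] (Y : PBond P j → E) (S : PBond P j → Prop) [DecidablePred S] :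
    ‖(fun b : PBond P j => if S b then Y b else 0)‖ ≤ ∑ b ∈ Finset.univ.filter S, ‖Y b‖ := by
  classical
  refine (pi_norm_le_iff_of_nonneg (Finset.sum_nonneg fun _ _ => norm_nonneg _)).2 fun b => ?_
  by_cases hb : S b
  · simp only [hb, if_true]
    have hmem : b ∈ Finset.univ.filter S := by rw [Finset.mem_filter]; exact ⟨Finset.mem_univ _, hb⟩
    exact Finset.single_le_sum (f := fun b => ‖Y b‖) (fun b _ => norm_nonneg _) hmem
  · simp only [hb, if_false, norm_zero]
    exact Finset.sum_nonneg fun _ _ => norm_nonneg _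

/-- `‖D_VΦ‖_{ℓ¹(bonds)} ≤ 2d·‖Φ‖_{ℓ¹(sites)}` (every site is the initial point of `d` bonds and the final point of `d` bonds). [cite: Balaban1985Averaging, (62) p.28 (bookkeeping)] -/
theorem sum_norm_covGrad_le {k : ℕ} (V : GaugeField P k (SU N)) (Φ : Site P k → Matrix (Fin N) (Fin N) ℂ) :
    ∑ b : PBond P k, ‖Φ b.src - ((V b : SU N) : Matrix (Fin N) (Fin N) ℂ) * Φ b.tgt * star ((V b : SU N) : Matrix (Fin N) (Fin N) ℂ)‖ ≤
      2 * (P.d : ℝ) * ∑ x : Site P k, ‖Φ x‖ := by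
  have hconj : ∀ b : PBond P k, ‖((V b : SU N) : Matrix (Fin N) (Fin N) ℂ) * Φ b.tgt * star ((V b : SU N) : Matrix (Fin N) (Fin N) ℂ)‖ ≤ ‖Φ b.tgt‖ := by
    intro b
    calc _ ≤ ‖((V b : SU N) : Matrix (Fin N) (Fin N) ℂ)‖ * ‖Φ b.tgt‖ * ‖star ((V b : SU N) : Matrix (Fin N) (Fin N) ℂ)‖ :=
          (norm_mul_le _ _).trans (mul_le_mul_of_nonneg_right (norm_mul_le _ _) (norm_nonneg _))
      _ = ‖Φ b.tgt‖ := by rw [norm_coe_eq_one, norm_star_coe_eq_one, one_mul, mul_one]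
  calc _ ≤ ∑ b : PBond P k, (‖Φ b.src‖ + ‖Φ b.tgt‖) := Finset.sum_le_sum fun b _ => (norm_sub_le _ _).trans (add_le_add le_rfl (hconj b))
    _ = 2 * (P.d : ℝ) * ∑ x : Site P k, ‖Φ x‖ := by
        rw [Finset.sum_add_distrib, sum_bond_src (F := fun x => ‖Φ x‖), sum_bond_tgt (F := fun x => ‖Φ x‖), nsmul_eq_mul]; ring

/-- `‖Y‖_{ℓ¹} ≤ ‖M‖_{ℓ¹} + 2d·‖Φ‖_{ℓ¹(sites)}` for `Y = M + D_VΦ`. [folklore] -/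
theorem sum_norm_le_of_decomp {k : ℕ} (V : GaugeField P k (SU N)) (Y M : PBond P k → Matrix (Fin N) (Fin N) ℂ) (Φ : Site P k → Matrix (Fin N) (Fin N) ℂ)
    (hdec : ∀ b : PBond P k, Y b = M b + (Φ b.src - ((V b : SU N) : Matrix (Fin N) (Fin N) ℂ) * Φ b.tgt * star ((V b : SU N) : Matrix (Fin N) (Fin N) ℂ))) :
    ∑ b : PBond P k, ‖Y b‖ ≤ ∑ b : PBond P k, ‖M b‖ + 2 * (P.d : ℝ) * ∑ x : Site P k, ‖Φ x‖ := by
  calc ∑ b : PBond P k, ‖Y b‖ ≤ ∑ b : PBond P k, (‖M b‖ + ‖Φ b.src - ((V b : SU N) : Matrix (Fin N) (Fin N) ℂ) * Φ b.tgt * star ((V b : SU N) : Matrix (Fin N) (Fin N) ℂ)‖) :=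
        Finset.sum_le_sum fun b _ => by rw [hdec b]; exact norm_add_le _ _
    _ ≤ _ := by rw [Finset.sum_add_distrib]; exact add_le_add le_rfl (sum_norm_covGrad_le V Φ)

end Letters

/-! ## §2 (s2′) with the local sup on the right -/

section StructureLocal

/-- ★ **(s2′), LOCAL-SUP FORM**: `‖Q₁^{R₀}(V)M(c) − (LM_V(M)(c) + SM_V(M)(c₋) − Ū(c)·SM_V(M)(c₊)·Ū(c)*)‖ ≤ 6α(d+2)L·‖M^{(c)}‖`, `M^{(c)}` the truncation of `M` to the bonds issuing from
`B(c₋) ∪ B(c₊)` (✓(s2′) at `M^{(c)}`; all four terms read `M` only there — staircases stay in their block, the segment crosses from `B(c₋)` to `B(c₊)`).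
[cite: Balaban1985Averaging, Prop. 3 (124)-(126) p.36, p.19] -/
theorem norm_covLinAvgR0_sub_structure_avgFun_le_local (hj : j + 1 ≤ P.m + P.K) (U₀ : GaugeField P j (SU N)) (M : PBond P j → Matrix (Fin N) (Fin N) ℂ)
    (c : PBond P (j + 1)) {α : ℝ} (hα : ∀ i : Idx P, dist1 (loopHol U₀ c i) ≤ α) (hαδ : α < deltaSU (Fin N)) (hα6 : α ≤ 1 / 6) :
    ‖covLinAvgR0 U₀ M c
        - (((Fintype.card (Idx P) : ℂ))⁻¹ • ∑ i : Idx P,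
              ((holAt U₀ (walk (emb c.src) (stairWord i.2.1 (off i.1))) : SU N) : Matrix (Fin N) (Fin N) ℂ) *
                covWalkSum U₀ M (walk (walkEnd (emb c.src) (stairWord i.2.1 (off i.1))) (List.replicate P.L (c.dir, true))) *
              star ((holAt U₀ (walk (emb c.src) (stairWord i.2.1 (off i.1))) : SU N) : Matrix (Fin N) (Fin N) ℂ)
          + ((Fintype.card (Idx P) : ℂ))⁻¹ • ∑ i : Idx P, covWalkSum U₀ M (walk (emb c.src) (stairWord i.2.1 (off i.1)))
          - ((avgFun (expMeanLogSU (n := Fin N)) U₀ c : SU N) : Matrix (Fin N) (Fin N) ℂ) *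
              (((Fintype.card (Idx P) : ℂ))⁻¹ • ∑ i : Idx P, covWalkSum U₀ M (walk (emb c.tgt) (stairWord i.2.1 (off i.1)))) *
            star ((avgFun (expMeanLogSU (n := Fin N)) U₀ c : SU N) : Matrix (Fin N) (Fin N) ℂ))‖
      ≤ 6 * α * ((((P.d + 2) * P.L : ℕ) : ℝ) * ‖(fun b : PBond P j => if blockOf b.src = c.src ∨ blockOf b.src = c.tgt then M b else 0)‖) := by
  classical
  set Mc : PBond P j → Matrix (Fin N) (Fin N) ℂ := fun b => if blockOf b.src = c.src ∨ blockOf b.src = c.tgt then M b else 0 with hMc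
  have hagree : ∀ b : PBond P j, (blockOf b.src = c.src ∨ blockOf b.src = c.tgt) → M b = Mc b := fun b hb => by
    simp only [hMc, hb, if_true]
  have h := norm_covLinAvgR0_sub_structure_avgFun_le U₀ Mc c hα hαδ hα6
  have hQ : covLinAvgR0 U₀ M c = covLinAvgR0 U₀ Mc c := covLinAvgR0_local hj U₀ c hagree
  have hL : ∀ i : Idx P, covWalkSum U₀ M (walk (walkEnd (emb c.src) (stairWord i.2.1 (off i.1))) (List.replicate P.L (c.dir, true))) =
      covWalkSum U₀ Mc (walk (walkEnd (emb c.src) (stairWord i.2.1 (off i.1))) (List.replicate P.L (c.dir, true))) :=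
    fun i => covWalkSum_congr U₀ _ fun s hs => hagree s.bond (blockOf_src_of_mem_line hj c i.2.1 i.1 s hs)
  have hS : ∀ i : Idx P, covWalkSum U₀ M (walk (emb c.src) (stairWord i.2.1 (off i.1))) = covWalkSum U₀ Mc (walk (emb c.src) (stairWord i.2.1 (off i.1))) :=
    fun i => covWalkSum_congr U₀ _ fun s hs => hagree s.bond (Or.inl (stair_src_tgt_blockOf hj c.src i.2.1 i.1 s hs).1)
  have hT : ∀ i : Idx P, covWalkSum U₀ M (walk (emb c.tgt) (stairWord i.2.1 (off i.1))) = covWalkSum U₀ Mc (walk (emb c.tgt) (stairWord i.2.1 (off i.1))) :=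
    fun i => covWalkSum_congr U₀ _ fun s hs => hagree s.bond (Or.inr (stair_src_tgt_blockOf hj c.tgt i.2.1 i.1 s hs).1)
  rw [hQ]
  simp only [hL, hS, hT]
  exact h

end StructureLocal

/-! ## §3 One step of the decomposition in `ℓ¹` -/

section Step

/-- ★★ **ONE STEP OF THE DECOMPOSITION, IN `ℓ¹`** (same `M′`, `Φ′` as ✓`decomp_step`; no derivatives).  If `Y = M + D_VΦ` at level `j` (standing range `j + 1 ≤ m + K`), the loop
variables of `V` are within `α` of `1` (`α ≤ 1∕6`, `α < δ_N`), and `Y′` at level `j+1` satisfies the LOCAL defect bound `‖Y′(c) − Q₁^{R₀}(V)Y(c)‖ ≤ r·Σ_{b ∈ blocks(c)} ‖Y b‖`, then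
`Y′ = M′ + D_{ŪV}Φ′` with `‖M′‖₁ ≤ (ρ + 12dℓα + 2dr)·‖M‖₁ + (6dα + 4d²r)·‖Φ‖₁` and `‖Φ′‖₁ ≤ ℓ·‖M‖₁ + ‖Φ‖₁`, where `ρ = (d!)²L∕|I|` (`= L^{1−d}`), `ℓ = (d+2)L`,
`‖Φ‖₁ = Σ_x ‖Φ x‖`. [cite: Balaban1985Averaging, Prop. 3 (124)-(126) p.36, (139)-(147) pp.39-40] -/
theorem decomp_step_ell1 (hj : j + 1 ≤ P.m + P.K) (V : GaugeField P j (SU N)) {α r : ℝ} (hα : ∀ (c : PBond P (j + 1)) (idx : Idx P), dist1 (loopHol V c idx) ≤ α)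
    (hαδ : α < deltaSU (Fin N)) (hα6 : α ≤ 1 / 6) (hα0 : 0 ≤ α) (hr : 0 ≤ r)
    (Y M : PBond P j → Matrix (Fin N) (Fin N) ℂ) (Φ : Site P j → Matrix (Fin N) (Fin N) ℂ)
    (hdec : ∀ b : PBond P j, Y b = M b + (Φ b.src - ((V b : SU N) : Matrix (Fin N) (Fin N) ℂ) * Φ b.tgt * star ((V b : SU N) : Matrix (Fin N) (Fin N) ℂ)))
    (Y' : PBond P (j + 1) → Matrix (Fin N) (Fin N) ℂ)
    (hY' : ∀ c : PBond P (j + 1), ‖Y' c - covLinAvgR0 V Y c‖ ≤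
      r * ∑ b ∈ Finset.univ.filter (fun b : PBond P j => blockOf b.src = c.src ∨ blockOf b.src = c.tgt), ‖Y b‖) :
    ∃ (M' : PBond P (j + 1) → Matrix (Fin N) (Fin N) ℂ) (Φ' : Site P (j + 1) → Matrix (Fin N) (Fin N) ℂ),
      (∀ c : PBond P (j + 1), Y' c = M' c + (Φ' c.src - ((avgFun (expMeanLogSU (n := Fin N)) V c : SU N) : Matrix (Fin N) (Fin N) ℂ) * Φ' c.tgt *
        star ((avgFun (expMeanLogSU (n := Fin N)) V c : SU N) : Matrix (Fin N) (Fin N) ℂ))) ∧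
      ∑ c : PBond P (j + 1), ‖M' c‖ ≤
        (((Fintype.card (Equiv.Perm (Fin P.d)) * Fintype.card (Equiv.Perm (Fin P.d)) : ℕ) : ℝ) * (P.L : ℝ) / (Fintype.card (Idx P) : ℝ) +
            12 * (P.d : ℝ) * (((P.d + 2) * P.L : ℕ) : ℝ) * α + 2 * (P.d : ℝ) * r) * ∑ b : PBond P j, ‖M b‖ +
          (6 * (P.d : ℝ) * α + 4 * (P.d : ℝ) ^ 2 * r) * ∑ x : Site P j, ‖Φ x‖ ∧
      ∑ y : Site P (j + 1), ‖Φ' y‖ ≤ (((P.d + 2) * P.L : ℕ) : ℝ) * ∑ b : PBond P j, ‖M b‖ + ∑ x : Site P j, ‖Φ x‖ := by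
  classical
  -- letters
  set I : ℝ := (Fintype.card (Idx P) : ℝ) with hI
  have hI0 : 0 < I := by rw [hI]; exact_mod_cast Fintype.card_pos
  set ℓ : ℝ := (((P.d + 2) * P.L : ℕ) : ℝ) with hℓ
  set m : ℝ := ∑ b : PBond P j, ‖M b‖ with hm
  set φ : ℝ := ∑ x : Site P j, ‖Φ x‖ with hφ
  have hm0 : 0 ≤ m := Finset.sum_nonneg fun _ _ => norm_nonneg _
  have hφ0 : 0 ≤ φ := Finset.sum_nonneg fun _ _ => norm_nonneg _
  -- the new fields (as in ✓`decomp_step`)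
  refine ⟨fun c => Y' c - ((((Fintype.card (Idx P) : ℂ))⁻¹ • ∑ idx : Idx P, covWalkSum V M (walk (emb c.src) (stairWord idx.2.1 (off idx.1))) + Φ (emb c.src)) -
      ((avgFun (expMeanLogSU (n := Fin N)) V c : SU N) : Matrix (Fin N) (Fin N) ℂ) *
        (((Fintype.card (Idx P) : ℂ))⁻¹ • ∑ idx : Idx P, covWalkSum V M (walk (emb c.tgt) (stairWord idx.2.1 (off idx.1))) + Φ (emb c.tgt)) *
      star ((avgFun (expMeanLogSU (n := Fin N)) V c : SU N) : Matrix (Fin N) (Fin N) ℂ)),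
    fun y => ((Fintype.card (Idx P) : ℂ))⁻¹ • ∑ idx : Idx P, covWalkSum V M (walk (emb y) (stairWord idx.2.1 (off idx.1))) + Φ (emb y),
    fun c => (sub_add_cancel _ _).symm, ?_, ?_⟩
  · -- the `ℓ¹` bound of `M′`: four terms per coarse bond
    have hdecY : Y = M + fun b => Φ b.src - ((V b : SU N) : Matrix (Fin N) (Fin N) ℂ) * Φ b.tgt * star ((V b : SU N) : Matrix (Fin N) (Fin N) ℂ) := by
      funext b; exact hdec b
    have hper : ∀ c : PBond P (j + 1),
        ‖Y' c - ((((Fintype.card (Idx P) : ℂ))⁻¹ • ∑ idx : Idx P, covWalkSum V M (walk (emb c.src) (stairWord idx.2.1 (off idx.1))) + Φ (emb c.src)) -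
          ((avgFun (expMeanLogSU (n := Fin N)) V c : SU N) : Matrix (Fin N) (Fin N) ℂ) *
            (((Fintype.card (Idx P) : ℂ))⁻¹ • ∑ idx : Idx P, covWalkSum V M (walk (emb c.tgt) (stairWord idx.2.1 (off idx.1))) + Φ (emb c.tgt)) *
          star ((avgFun (expMeanLogSU (n := Fin N)) V c : SU N) : Matrix (Fin N) (Fin N) ℂ))‖ ≤
        r * (∑ b ∈ Finset.univ.filter (fun b : PBond P j => blockOf b.src = c.src ∨ blockOf b.src = c.tgt), ‖Y b‖) +
          6 * α * (ℓ * ∑ b ∈ Finset.univ.filter (fun b : PBond P j => blockOf b.src = c.src ∨ blockOf b.src = c.tgt), ‖M b‖) +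
          6 * α * ‖Φ (emb c.tgt)‖ +
          I⁻¹ * ∑ idx : Idx P, ((walk (walkEnd (emb c.src) (stairWord idx.2.1 (off idx.1))) (List.replicate P.L (c.dir, true))).map fun s => ‖M s.bond‖).sum := by
      intro c
      have hsplit : covLinAvgR0 V Y c = covLinAvgR0 V M c +
          covLinAvgR0 V (fun b => Φ b.src - ((V b : SU N) : Matrix (Fin N) (Fin N) ℂ) * Φ b.tgt * star ((V b : SU N) : Matrix (Fin N) (Fin N) ℂ)) c := by
        rw [hdecY, covLinAvgR0_add]
      have h1 := hY' c
      have h2 := (norm_covLinAvgR0_sub_structure_avgFun_le_local hj V M c (hα c) hαδ hα6).trans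
        (mul_le_mul_of_nonneg_left (mul_le_mul_of_nonneg_left
          (norm_truncate_le_sum M (fun b : PBond P j => blockOf b.src = c.src ∨ blockOf b.src = c.tgt)) (by positivity)) (by positivity))
      have h3 := norm_covLinAvgR0_covGrad_sub_le V Φ c (hα c) hαδ hα6
      have h4 : ‖((Fintype.card (Idx P) : ℂ))⁻¹ • ∑ idx : Idx P,
          ((holAt V (walk (emb c.src) (stairWord idx.2.1 (off idx.1))) : SU N) : Matrix (Fin N) (Fin N) ℂ) *
            covWalkSum V M (walk (walkEnd (emb c.src) (stairWord idx.2.1 (off idx.1))) (List.replicate P.L (c.dir, true))) *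
          star ((holAt V (walk (emb c.src) (stairWord idx.2.1 (off idx.1))) : SU N) : Matrix (Fin N) (Fin N) ℂ)‖ ≤
          I⁻¹ * ∑ idx : Idx P, ((walk (walkEnd (emb c.src) (stairWord idx.2.1 (off idx.1))) (List.replicate P.L (c.dir, true))).map fun s => ‖M s.bond‖).sum := by
        refine (norm_mean_le_mean_norm _).trans (mul_le_mul_of_nonneg_left (Finset.sum_le_sum fun idx _ => ?_) (inv_nonneg.2 hI0.le))
        have hconj : ∀ (g : SU N) (X : Matrix (Fin N) (Fin N) ℂ), ‖(g : Matrix (Fin N) (Fin N) ℂ) * X * star (g : Matrix (Fin N) (Fin N) ℂ)‖ ≤ ‖X‖ := by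
          intro g X
          calc _ ≤ ‖(g : Matrix (Fin N) (Fin N) ℂ)‖ * ‖X‖ * ‖star (g : Matrix (Fin N) (Fin N) ℂ)‖ :=
                (norm_mul_le _ _).trans (mul_le_mul_of_nonneg_right (norm_mul_le _ _) (norm_nonneg _))
            _ = ‖X‖ := by rw [norm_coe_eq_one, norm_star_coe_eq_one, one_mul, mul_one]
        exact (hconj _ _).trans (norm_covWalkSum_le_sum V M _)
      set QM := covLinAvgR0 V M c with hQM
      set QG := covLinAvgR0 V (fun b => Φ b.src - ((V b : SU N) : Matrix (Fin N) (Fin N) ℂ) * Φ b.tgt * star ((V b : SU N) : Matrix (Fin N) (Fin N) ℂ)) c with hQG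
      set LMc := ((Fintype.card (Idx P) : ℂ))⁻¹ • ∑ idx : Idx P,
          ((holAt V (walk (emb c.src) (stairWord idx.2.1 (off idx.1))) : SU N) : Matrix (Fin N) (Fin N) ℂ) *
            covWalkSum V M (walk (walkEnd (emb c.src) (stairWord idx.2.1 (off idx.1))) (List.replicate P.L (c.dir, true))) *
          star ((holAt V (walk (emb c.src) (stairWord idx.2.1 (off idx.1))) : SU N) : Matrix (Fin N) (Fin N) ℂ) with hLMc
      set SMs := ((Fintype.card (Idx P) : ℂ))⁻¹ • ∑ idx : Idx P, covWalkSum V M (walk (emb c.src) (stairWord idx.2.1 (off idx.1))) with hSMs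
      set SMt := ((Fintype.card (Idx P) : ℂ))⁻¹ • ∑ idx : Idx P, covWalkSum V M (walk (emb c.tgt) (stairWord idx.2.1 (off idx.1))) with hSMt
      set u : Matrix (Fin N) (Fin N) ℂ := ((avgFun (expMeanLogSU (n := Fin N)) V c : SU N) : Matrix (Fin N) (Fin N) ℂ) with hu
      have e : Y' c - ((SMs + Φ (emb c.src)) - u * (SMt + Φ (emb c.tgt)) * star u) =
          (Y' c - (QM + QG)) + (QM - (LMc + SMs - u * SMt * star u)) + (QG - (Φ (emb c.src) - u * Φ (emb c.tgt) * star u)) + LMc := by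
        noncomm_ring
      rw [e]
      rw [hsplit] at h1
      calc ‖(Y' c - (QM + QG)) + (QM - (LMc + SMs - u * SMt * star u)) + (QG - (Φ (emb c.src) - u * Φ (emb c.tgt) * star u)) + LMc‖
          ≤ ‖Y' c - (QM + QG)‖ + ‖QM - (LMc + SMs - u * SMt * star u)‖ + ‖QG - (Φ (emb c.src) - u * Φ (emb c.tgt) * star u)‖ + ‖LMc‖ :=
            (norm_add_le _ _).trans (add_le_add ((norm_add_le _ _).trans (add_le_add (norm_add_le _ _) le_rfl)) le_rfl)
        _ ≤ _ := add_le_add (add_le_add (add_le_add h1 h2) h3) h4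
    -- sum over coarse bonds, then the three counts
    have hY1 : ∑ b : PBond P j, ‖Y b‖ ≤ m + 2 * (P.d : ℝ) * φ := sum_norm_le_of_decomp V Y M Φ hdec
    have hT1 : ∑ c : PBond P (j + 1), ∑ b ∈ Finset.univ.filter (fun b : PBond P j => blockOf b.src = c.src ∨ blockOf b.src = c.tgt), ‖Y b‖ ≤
        2 * (P.d : ℝ) * ∑ b : PBond P j, ‖Y b‖ := sum_sum_twoBlock_le (fun b => ‖Y b‖) fun _ => norm_nonneg _
    have hT2 : ∑ c : PBond P (j + 1), ∑ b ∈ Finset.univ.filter (fun b : PBond P j => blockOf b.src = c.src ∨ blockOf b.src = c.tgt), ‖M b‖ ≤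
        2 * (P.d : ℝ) * m := sum_sum_twoBlock_le (fun b => ‖M b‖) fun _ => norm_nonneg _
    have hT3 : ∑ c : PBond P (j + 1), ‖Φ (emb c.tgt)‖ ≤ (P.d : ℝ) * φ := by
      rw [sum_bond_tgt (F := fun y : Site P (j + 1) => ‖Φ (emb y)‖), nsmul_eq_mul]
      exact mul_le_mul_of_nonneg_left (sum_emb_le hj (fun x => ‖Φ x‖) fun _ => norm_nonneg _) (Nat.cast_nonneg _)
    have hT4 : ∑ c : PBond P (j + 1), ∑ idx : Idx P,
        ((walk (walkEnd (emb c.src) (stairWord idx.2.1 (off idx.1))) (List.replicate P.L (c.dir, true))).map fun s => ‖M s.bond‖).sum =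
        ((Fintype.card (Equiv.Perm (Fin P.d)) * Fintype.card (Equiv.Perm (Fin P.d)) : ℕ) : ℝ) * (P.L : ℝ) * m := sum_runSums_eq hj (fun b => ‖M b‖)
    calc ∑ c : PBond P (j + 1), ‖Y' c - ((((Fintype.card (Idx P) : ℂ))⁻¹ • ∑ idx : Idx P, covWalkSum V M (walk (emb c.src) (stairWord idx.2.1 (off idx.1))) + Φ (emb c.src)) -
          ((avgFun (expMeanLogSU (n := Fin N)) V c : SU N) : Matrix (Fin N) (Fin N) ℂ) *
            (((Fintype.card (Idx P) : ℂ))⁻¹ • ∑ idx : Idx P, covWalkSum V M (walk (emb c.tgt) (stairWord idx.2.1 (off idx.1))) + Φ (emb c.tgt)) *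
          star ((avgFun (expMeanLogSU (n := Fin N)) V c : SU N) : Matrix (Fin N) (Fin N) ℂ))‖
        ≤ ∑ c : PBond P (j + 1), (r * (∑ b ∈ Finset.univ.filter (fun b : PBond P j => blockOf b.src = c.src ∨ blockOf b.src = c.tgt), ‖Y b‖) +
            6 * α * (ℓ * ∑ b ∈ Finset.univ.filter (fun b : PBond P j => blockOf b.src = c.src ∨ blockOf b.src = c.tgt), ‖M b‖) +
            6 * α * ‖Φ (emb c.tgt)‖ +
            I⁻¹ * ∑ idx : Idx P, ((walk (walkEnd (emb c.src) (stairWord idx.2.1 (off idx.1))) (List.replicate P.L (c.dir, true))).map fun s => ‖M s.bond‖).sum) :=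
          Finset.sum_le_sum fun c _ => hper c
      _ = r * (∑ c : PBond P (j + 1), ∑ b ∈ Finset.univ.filter (fun b : PBond P j => blockOf b.src = c.src ∨ blockOf b.src = c.tgt), ‖Y b‖) +
          6 * α * ℓ * (∑ c : PBond P (j + 1), ∑ b ∈ Finset.univ.filter (fun b : PBond P j => blockOf b.src = c.src ∨ blockOf b.src = c.tgt), ‖M b‖) +
          6 * α * (∑ c : PBond P (j + 1), ‖Φ (emb c.tgt)‖) +
          I⁻¹ * (∑ c : PBond P (j + 1), ∑ idx : Idx P,
            ((walk (walkEnd (emb c.src) (stairWord idx.2.1 (off idx.1))) (List.replicate P.L (c.dir, true))).map fun s => ‖M s.bond‖).sum) := by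
          symm
          rw [Finset.mul_sum, Finset.mul_sum, Finset.mul_sum, Finset.mul_sum, ← Finset.sum_add_distrib, ← Finset.sum_add_distrib, ← Finset.sum_add_distrib]
          exact Finset.sum_congr rfl fun c _ => by ring
      _ ≤ r * (2 * (P.d : ℝ) * (m + 2 * (P.d : ℝ) * φ)) + 6 * α * ℓ * (2 * (P.d : ℝ) * m) + 6 * α * ((P.d : ℝ) * φ) +
          I⁻¹ * (((Fintype.card (Equiv.Perm (Fin P.d)) * Fintype.card (Equiv.Perm (Fin P.d)) : ℕ) : ℝ) * (P.L : ℝ) * m) := by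
          rw [hT4]
          have := hT1.trans (mul_le_mul_of_nonneg_left hY1 (by positivity))
          gcongr
      _ = _ := by rw [hI, hℓ]; ring
  · -- the `ℓ¹` bound of `Φ′`
    have hS : ∀ y : Site P (j + 1), ‖((Fintype.card (Idx P) : ℂ))⁻¹ • ∑ idx : Idx P, covWalkSum V M (walk (emb y) (stairWord idx.2.1 (off idx.1)))‖ ≤
        I⁻¹ * ∑ idx : Idx P, ((walk (emb y) (stairWord idx.2.1 (off idx.1))).map fun s => ‖M s.bond‖).sum := fun y =>
      (norm_mean_le_mean_norm _).trans (mul_le_mul_of_nonneg_left (Finset.sum_le_sum fun idx _ => norm_covWalkSum_le_sum V M _) (inv_nonneg.2 hI0.le))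
    have hst := sum_stairSums_le hj (g := fun b => ‖M b‖) (fun _ => norm_nonneg _) (fun idx : Idx P => idx.2.1)
    calc ∑ y : Site P (j + 1), ‖((Fintype.card (Idx P) : ℂ))⁻¹ • ∑ idx : Idx P, covWalkSum V M (walk (emb y) (stairWord idx.2.1 (off idx.1))) + Φ (emb y)‖
        ≤ ∑ y : Site P (j + 1), (I⁻¹ * ∑ idx : Idx P, ((walk (emb y) (stairWord idx.2.1 (off idx.1))).map fun s => ‖M s.bond‖).sum + ‖Φ (emb y)‖) :=
          Finset.sum_le_sum fun y _ => (norm_add_le _ _).trans (add_le_add (hS y) le_rfl)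
      _ = I⁻¹ * (∑ y : Site P (j + 1), ∑ idx : Idx P, ((walk (emb y) (stairWord idx.2.1 (off idx.1))).map fun s => ‖M s.bond‖).sum) +
          ∑ y : Site P (j + 1), ‖Φ (emb y)‖ := by rw [Finset.sum_add_distrib, ← Finset.mul_sum]
      _ ≤ I⁻¹ * (I * ℓ * m) + φ := add_le_add (mul_le_mul_of_nonneg_left hst (inv_nonneg.2 hI0.le)) (sum_emb_le hj (fun x => ‖Φ x‖) fun _ => norm_nonneg _)
      _ = ℓ * m + φ := by field_simp

end Step

end Summit.QuantumFields.YangMills.Theorems.FluctuationComparisonRegPrIntLS2BetaChartReadDerivKStepEllOne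

end
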